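import Summits.Ventures.AbcSig.Conjectures.LevelRaising32L2InstancesCensus
import Summits.Ventures.AbcSig.Levels.N5536
import Summits.Ventures.AbcSig.Levels.N5728
import Summits.Ventures.AbcSig.Levels.N6112
import Summits.Ventures.AbcSig.Levels.N6752
import Summits.Ventures.AbcSig.Levels.N7264
import Summits.Ventures.AbcSig.Levels.N7328
import Summits.Ventures.AbcSig.Levels.N7648
import Summits.Ventures.AbcSig.Levels.N7712
import Summits.Ventures.AbcSig.Levels.N8032
import Summits.Ventures.AbcSig.Levels.N8608
import Summits.Ventures.AbcSig.Levels.N8864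
import Summits.Ventures.AbcSig.Levels.N9376
import Summits.Ventures.AbcSig.Levels.N9952
import Summits.Ventures.AbcSig.Levels.N10144

/-!
# Venture AbcSig — `CONJ_LR32_L2` slices at the CENSUS levels `2⁵ℓ` already settled by the tree's coarse-sieve certificates (part 2: `173 ≤ ℓ ≤ 317`)

HONEST FRAMING. Support file of the computation cell `pub-abcsig`, companion of `Conjectures/LevelRaising32L2Instances.lean`
(p495825: the slice `CONJ_LR32_L2At`, `CONJ_LR32_L2At_of_eliminated`, four in-sample slices); the lemma `CONJ_LR32_L2At_of_eliminated_lr` used below is in part 1 (`LevelRaising32L2InstancesCensus.lean`). `CONJ_LR32_L2` (p490111) is a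
CONJECTURE over the abstract `NewformModel`; nothing here proves it or adds evidence for its content beyond what the level files
already certify. GENERATED MECHANICALLY (HOME/plean/g15/gen15/make_census_slices.py) from the plain level files `Levels/N<32ℓ>.lean`
that are in the tree: a level qualifies iff its `level<N>_sieve` theorem asks the row predicate `X` for NO orbit at any prime exponent
`n ≥ 17` other than primes in Ribet's level-raising set `R₃₂(ℓ) = {n : n ∣ (ℓ + 1)² − a_ℓ(32a)²}` (which the slice excludes by its
hypothesis `¬ LevelRaise a32 ℓ n`, checked here in the kernel by `decide` at each such `(ℓ, n)`). So every slice below is proved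
from the COMPUTED hypothesis `NewformModel.DataComplete` of its level file and NOTHING ELSE, by `CONJ_LR32_L2At_of_eliminated_lr`
(variant of `CONJ_LR32_L2At_of_eliminated` keeping the level-raising hypothesis): at these levels every newform passing the coarse
[BS04, Lemma 4.2] sieve modulo a prime above `n ≥ 17` does so at a LEVEL-RAISING exponent `n ∈ R₃₂(ℓ)` — the premise of the slice is
never met outside `R₃₂(ℓ)`. Numbers: 14 levels, ℓ ∈ {173, 179, 191, 211, 227, 229, 239, 241, 251, 269, 277, 293, 311, 317}; at 6 of them (ℓ ∈ {179, 191, 229, 239, 251, 311}) the coarse residual sets contain no prime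
`≥ 17` at all (vacuous as in the companion file); at the other 8 (ℓ ∈ {173, 211, 227, 241, 269, 277, 293, 317}) the residual primes `≥ 17` are
exactly level-raising primes (the cell's «ghosts of 32a», conjecture clause L1), discharged by the slice's hypothesis. WHAT THIS IS
NOT: the Kraus-table part of the premise and the `CongruentToFrey` conclusion stay idle in every proof here; census levels whose
residual primes `≥ 17` lie OUTSIDE `R₃₂(ℓ)` (closed in the rows of record by Kraus/M4 or other modules, e.g. `ℓ = 109, 181,
193`; at `(313; 23)` the a0 = `E₁` classes are OPEN in the certificates of record (kmax 40) — see HOME/STRUCTURE.md v3.18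
E-LR32-313) are NOT sliceable from the coarse certificates and are absent; levels whose tree
files the generator could not parse (other certificate formats) are absent too (no claim either way). Context: HOME/STRUCTURE.md §6 CONJ-LR32; registered test «E2-LR32-R2» (HOME/lead/PREDICTIONS-ODDHALVES-lead-g14.md l.81–l.83).
Nothing here is a claim on ABC or any summit.

References: [BS04] M. A. Bennett, C. M. Skinner, Canad. J. Math. 56 (2004) 23–54, Lemma 4.2; [Rib90b] K. Ribet, *Raising the levels of
modular representations*, Progr. Math. 81 (1990) 259–271, Thm 1.
-/

namespace Summit.Ventures.AbcSig.Conjectures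

open Summit.Ventures.AbcSig


/-- **`CONJ_LR32_L2` at `ℓ = 173` (level `5536 = 2⁵·173`) holds in every model whose level-5536 newforms are the listed certified orbits of
`Levels/N5536.lean`** (computed hypothesis `DataComplete`; the coarse residual primes `≥ 17` are [37] ⊆ `R₃₂(173)` = [2, 5, 37] (level raising, excluded by the slice hypothesis; `decide`)). -/
theorem CONJ_LR32_L2At_173 (M : NewformModel) (hD : M.DataComplete 5536 level5536Orbits) : CONJ_LR32_L2At M 173 :=
  CONJ_LR32_L2At_of_eliminated_lr M (by norm_num) hD level5536_wellformed fun n hn h17 _ hLR o ho =>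
    ((level5536_sieve n hn (by omega) (fun _ => False)
      (fun h => by
        simp only [List.mem_cons, List.not_mem_nil, or_false] at h
        rcases h with rfl
        all_goals first | omega | exact hLR (by decide +kernel))
      (fun h => by simp only [List.mem_cons, List.not_mem_nil, or_false] at h; omega)
      (fun h => by simp only [List.mem_cons, List.not_mem_nil, or_false] at h; omega) o ho).2).elim id False.elim

/-- **`CONJ_LR32_L2` at `ℓ = 179` (level `5728 = 2⁵·179`) holds in every model whose level-5728 newforms are the listed certified orbits of
`Levels/N5728.lean`** (computed hypothesis `DataComplete`; vacuous: the coarse residual exponents are all `< 17`). -/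
theorem CONJ_LR32_L2At_179 (M : NewformModel) (hD : M.DataComplete 5728 level5728Orbits) : CONJ_LR32_L2At M 179 :=
  CONJ_LR32_L2At_of_eliminated_lr M (by norm_num) hD level5728_wellformed fun n hn h17 _ _ o ho =>
    ((level5728_sieve n hn (by omega) (fun _ => False)
      (fun h => by simp only [List.mem_cons, List.not_mem_nil, or_false] at h; omega)
      (fun h => by simp only [List.mem_cons, List.not_mem_nil, or_false] at h; omega)
      (fun h => by simp only [List.mem_cons, List.not_mem_nil, or_false] at h; omega)
      (fun h => by simp only [List.mem_cons, List.not_mem_nil, or_false] at h; omega) o ho).2).elim id False.elim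

/-- **`CONJ_LR32_L2` at `ℓ = 191` (level `6112 = 2⁵·191`) holds in every model whose level-6112 newforms are the listed certified orbits of
`Levels/N6112.lean`** (computed hypothesis `DataComplete`; vacuous: the coarse residual exponents are all `< 17`). -/
theorem CONJ_LR32_L2At_191 (M : NewformModel) (hD : M.DataComplete 6112 level6112Orbits) : CONJ_LR32_L2At M 191 :=
  CONJ_LR32_L2At_of_eliminated_lr M (by norm_num) hD level6112_wellformed fun n hn h17 _ _ o ho =>
    ((level6112_sieve n hn (by omega) (fun _ => False)
      (fun h => by simp only [List.mem_cons, List.not_mem_nil, or_false] at h; omega)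
      (fun h => by simp only [List.mem_cons, List.not_mem_nil, or_false] at h; omega)
      (fun h => by simp only [List.mem_cons, List.not_mem_nil, or_false] at h; omega)
      (fun h => by simp only [List.mem_cons, List.not_mem_nil, or_false] at h; omega)
      (fun h => by simp only [List.mem_cons, List.not_mem_nil, or_false] at h; omega)
      (fun h => by simp only [List.mem_cons, List.not_mem_nil, or_false] at h; omega)
      (fun h => by simp only [List.mem_cons, List.not_mem_nil, or_false] at h; omega)
      (fun h => by simp only [List.mem_cons, List.not_mem_nil, or_false] at h; omega) o ho).2).elim id False.elim

/-- **`CONJ_LR32_L2` at `ℓ = 211` (level `6752 = 2⁵·211`) holds in every model whose level-6752 newforms are the listed certified orbits of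
`Levels/N6752.lean`** (computed hypothesis `DataComplete`; the coarse residual primes `≥ 17` are [53] ⊆ `R₃₂(211)` = [2, 53] (level raising, excluded by the slice hypothesis; `decide`)). -/
theorem CONJ_LR32_L2At_211 (M : NewformModel) (hD : M.DataComplete 6752 level6752Orbits) : CONJ_LR32_L2At M 211 :=
  CONJ_LR32_L2At_of_eliminated_lr M (by norm_num) hD level6752_wellformed fun n hn h17 _ hLR o ho =>
    ((level6752_sieve n hn (by omega) (fun _ => False)
      (fun h => by simp only [List.mem_cons, List.not_mem_nil, or_false] at h; omega)
      (fun h => by simp only [List.mem_cons, List.not_mem_nil, or_false] at h; omega)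
      (fun h => by simp only [List.mem_cons, List.not_mem_nil, or_false] at h; omega)
      (fun h => by simp only [List.mem_cons, List.not_mem_nil, or_false] at h; omega)
      (fun h => by simp only [List.mem_cons, List.not_mem_nil, or_false] at h; omega)
      (fun h => by simp only [List.mem_cons, List.not_mem_nil, or_false] at h; omega)
      (fun h => by
        simp only [List.mem_cons, List.not_mem_nil, or_false] at h
        rcases h with rfl
        all_goals first | omega | exact hLR (by decide +kernel))
      (fun h => by
        simp only [List.mem_cons, List.not_mem_nil, or_false] at h
        rcases h with rfl
        all_goals first | omega | exact hLR (by decide +kernel)) o ho).2).elim id False.elim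

/-- **`CONJ_LR32_L2` at `ℓ = 227` (level `7264 = 2⁵·227`) holds in every model whose level-7264 newforms are the listed certified orbits of
`Levels/N7264.lean`** (computed hypothesis `DataComplete`; the coarse residual primes `≥ 17` are [19] ⊆ `R₃₂(227)` = [2, 3, 19] (level raising, excluded by the slice hypothesis; `decide`)). -/
theorem CONJ_LR32_L2At_227 (M : NewformModel) (hD : M.DataComplete 7264 level7264Orbits) : CONJ_LR32_L2At M 227 :=
  CONJ_LR32_L2At_of_eliminated_lr M (by norm_num) hD level7264_wellformed fun n hn h17 _ hLR o ho =>
    ((level7264_sieve n hn (by omega) (fun _ => False)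
      (fun h => by
        simp only [List.mem_cons, List.not_mem_nil, or_false] at h
        rcases h with rfl | rfl
        all_goals first | omega | exact hLR (by decide +kernel))
      (fun h => by
        simp only [List.mem_cons, List.not_mem_nil, or_false] at h
        rcases h with rfl | rfl
        all_goals first | omega | exact hLR (by decide +kernel))
      (fun h => by simp only [List.mem_cons, List.not_mem_nil, or_false] at h; omega)
      (fun h => by simp only [List.mem_cons, List.not_mem_nil, or_false] at h; omega) o ho).2).elim id False.elim

/-- **`CONJ_LR32_L2` at `ℓ = 229` (level `7328 = 2⁵·229`) holds in every model whose level-7328 newforms are the listed certified orbits of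
`Levels/N7328.lean`** (computed hypothesis `DataComplete`; vacuous: the coarse residual exponents are all `< 17`). -/
theorem CONJ_LR32_L2At_229 (M : NewformModel) (hD : M.DataComplete 7328 level7328Orbits) : CONJ_LR32_L2At M 229 :=
  CONJ_LR32_L2At_of_eliminated_lr M (by norm_num) hD level7328_wellformed fun n hn h17 _ _ o ho =>
    ((level7328_sieve n hn (by omega) (fun _ => False)
      (fun h => by simp only [List.mem_cons, List.not_mem_nil, or_false] at h; omega)
      (fun h => by simp only [List.mem_cons, List.not_mem_nil, or_false] at h; omega)
      (fun h => by simp only [List.mem_cons, List.not_mem_nil, or_false] at h; omega)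
      (fun h => by simp only [List.mem_cons, List.not_mem_nil, or_false] at h; omega)
      (fun h => by simp only [List.mem_cons, List.not_mem_nil, or_false] at h; omega) o ho).2).elim id False.elim

/-- **`CONJ_LR32_L2` at `ℓ = 239` (level `7648 = 2⁵·239`) holds in every model whose level-7648 newforms are the listed certified orbits of
`Levels/N7648.lean`** (computed hypothesis `DataComplete`; vacuous: the coarse residual exponents are all `< 17`). -/
theorem CONJ_LR32_L2At_239 (M : NewformModel) (hD : M.DataComplete 7648 level7648Orbits) : CONJ_LR32_L2At M 239 :=
  CONJ_LR32_L2At_of_eliminated_lr M (by norm_num) hD level7648_wellformed fun n hn h17 _ _ o ho =>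
    ((level7648_sieve n hn (by omega) (fun _ => False)
      (fun h => by simp only [List.mem_cons, List.not_mem_nil, or_false] at h; omega)
      (fun h => by simp only [List.mem_cons, List.not_mem_nil, or_false] at h; omega)
      (fun h => by simp only [List.mem_cons, List.not_mem_nil, or_false] at h; omega)
      (fun h => by simp only [List.mem_cons, List.not_mem_nil, or_false] at h; omega)
      (fun h => by simp only [List.mem_cons, List.not_mem_nil, or_false] at h; omega)
      (fun h => by simp only [List.mem_cons, List.not_mem_nil, or_false] at h; omega)
      (fun h => by simp only [List.mem_cons, List.not_mem_nil, or_false] at h; omega)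
      (fun h => by simp only [List.mem_cons, List.not_mem_nil, or_false] at h; omega) o ho).2).elim id False.elim

/-- **`CONJ_LR32_L2` at `ℓ = 241` (level `7712 = 2⁵·241`) holds in every model whose level-7712 newforms are the listed certified orbits of
`Levels/N7712.lean`** (computed hypothesis `DataComplete`; the coarse residual primes `≥ 17` are [17, 53] ⊆ `R₃₂(241)` = [2, 17, 53] (level raising, excluded by the slice hypothesis; `decide`)). -/
theorem CONJ_LR32_L2At_241 (M : NewformModel) (hD : M.DataComplete 7712 level7712Orbits) : CONJ_LR32_L2At M 241 :=
  CONJ_LR32_L2At_of_eliminated_lr M (by norm_num) hD level7712_wellformed fun n hn h17 _ hLR o ho =>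
    ((level7712_sieve n hn (by omega) (fun _ => False)
      (fun h => by
        simp only [List.mem_cons, List.not_mem_nil, or_false] at h
        rcases h with rfl | rfl
        all_goals first | omega | exact hLR (by decide +kernel))
      (fun h => by simp only [List.mem_cons, List.not_mem_nil, or_false] at h; omega)
      (fun h => by simp only [List.mem_cons, List.not_mem_nil, or_false] at h; omega)
      (fun h => by
        simp only [List.mem_cons, List.not_mem_nil, or_false] at h
        rcases h with rfl
        all_goals first | omega | exact hLR (by decide +kernel)) o ho).2).elim id False.elim

/-- **`CONJ_LR32_L2` at `ℓ = 251` (level `8032 = 2⁵·251`) holds in every model whose level-8032 newforms are the listed certified orbits of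
`Levels/N8032.lean`** (computed hypothesis `DataComplete`; vacuous: the coarse residual exponents are all `< 17`). -/
theorem CONJ_LR32_L2At_251 (M : NewformModel) (hD : M.DataComplete 8032 level8032Orbits) : CONJ_LR32_L2At M 251 :=
  CONJ_LR32_L2At_of_eliminated_lr M (by norm_num) hD level8032_wellformed fun n hn h17 _ _ o ho =>
    ((level8032_sieve n hn (by omega) (fun _ => False)
      (fun h => by simp only [List.mem_cons, List.not_mem_nil, or_false] at h; omega)
      (fun h => by simp only [List.mem_cons, List.not_mem_nil, or_false] at h; omega)
      (fun h => by simp only [List.mem_cons, List.not_mem_nil, or_false] at h; omega)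
      (fun h => by simp only [List.mem_cons, List.not_mem_nil, or_false] at h; omega)
      (fun h => by simp only [List.mem_cons, List.not_mem_nil, or_false] at h; omega)
      (fun h => by simp only [List.mem_cons, List.not_mem_nil, or_false] at h; omega)
      (fun h => by simp only [List.mem_cons, List.not_mem_nil, or_false] at h; omega)
      (fun h => by simp only [List.mem_cons, List.not_mem_nil, or_false] at h; omega)
      (fun h => by simp only [List.mem_cons, List.not_mem_nil, or_false] at h; omega)
      (fun h => by simp only [List.mem_cons, List.not_mem_nil, or_false] at h; omega) o ho).2).elim id False.elim

/-- **`CONJ_LR32_L2` at `ℓ = 269` (level `8608 = 2⁵·269`) holds in every model whose level-8608 newforms are the listed certified orbits of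
`Levels/N8608.lean`** (computed hypothesis `DataComplete`; the coarse residual primes `≥ 17` are [37, 61] ⊆ `R₃₂(269)` = [2, 37, 61] (level raising, excluded by the slice hypothesis; `decide`)). -/
theorem CONJ_LR32_L2At_269 (M : NewformModel) (hD : M.DataComplete 8608 level8608Orbits) : CONJ_LR32_L2At M 269 :=
  CONJ_LR32_L2At_of_eliminated_lr M (by norm_num) hD level8608_wellformed fun n hn h17 _ hLR o ho =>
    ((level8608_sieve n hn (by omega) (fun _ => False)
      (fun h => by simp only [List.mem_cons, List.not_mem_nil, or_false] at h; omega)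
      (fun h => by simp only [List.mem_cons, List.not_mem_nil, or_false] at h; omega)
      (fun h => by simp only [List.mem_cons, List.not_mem_nil, or_false] at h; omega)
      (fun h => by simp only [List.mem_cons, List.not_mem_nil, or_false] at h; omega)
      (fun h => by
        simp only [List.mem_cons, List.not_mem_nil, or_false] at h
        rcases h with rfl
        all_goals first | omega | exact hLR (by decide +kernel))
      (fun h => by
        simp only [List.mem_cons, List.not_mem_nil, or_false] at h
        rcases h with rfl | rfl
        all_goals first | omega | exact hLR (by decide +kernel))
      (fun h => by simp only [List.mem_cons, List.not_mem_nil, or_false] at h; omega)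
      (fun h => by simp only [List.mem_cons, List.not_mem_nil, or_false] at h; omega)
      (fun h => by simp only [List.mem_cons, List.not_mem_nil, or_false] at h; omega)
      (fun h => by simp only [List.mem_cons, List.not_mem_nil, or_false] at h; omega) o ho).2).elim id False.elim

/-- **`CONJ_LR32_L2` at `ℓ = 277` (level `8864 = 2⁵·277`) holds in every model whose level-8864 newforms are the listed certified orbits of
`Levels/N8864.lean`** (computed hypothesis `DataComplete`; the coarse residual primes `≥ 17` are [37] ⊆ `R₃₂(277)` = [2, 5, 13, 37] (level raising, excluded by the slice hypothesis; `decide`)). -/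
theorem CONJ_LR32_L2At_277 (M : NewformModel) (hD : M.DataComplete 8864 level8864Orbits) : CONJ_LR32_L2At M 277 :=
  CONJ_LR32_L2At_of_eliminated_lr M (by norm_num) hD level8864_wellformed fun n hn h17 _ hLR o ho =>
    ((level8864_sieve n hn (by omega) (fun _ => False)
      (fun h => by simp only [List.mem_cons, List.not_mem_nil, or_false] at h; omega)
      (fun h => by simp only [List.mem_cons, List.not_mem_nil, or_false] at h; omega)
      (fun h => by
        simp only [List.mem_cons, List.not_mem_nil, or_false] at h
        rcases h with rfl
        all_goals first | omega | exact hLR (by decide +kernel))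
      (fun h => by simp only [List.mem_cons, List.not_mem_nil, or_false] at h; omega)
      (fun h => by simp only [List.mem_cons, List.not_mem_nil, or_false] at h; omega)
      (fun h => by simp only [List.mem_cons, List.not_mem_nil, or_false] at h; omega)
      (fun h => by simp only [List.mem_cons, List.not_mem_nil, or_false] at h; omega) o ho).2).elim id False.elim

/-- **`CONJ_LR32_L2` at `ℓ = 293` (level `9376 = 2⁵·293`) holds in every model whose level-9376 newforms are the listed certified orbits of
`Levels/N9376.lean`** (computed hypothesis `DataComplete`; the coarse residual primes `≥ 17` are [41] ⊆ `R₃₂(293)` = [2, 5, 13, 41] (level raising, excluded by the slice hypothesis; `decide`)). -/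
theorem CONJ_LR32_L2At_293 (M : NewformModel) (hD : M.DataComplete 9376 level9376Orbits) : CONJ_LR32_L2At M 293 :=
  CONJ_LR32_L2At_of_eliminated_lr M (by norm_num) hD level9376_wellformed fun n hn h17 _ hLR o ho =>
    ((level9376_sieve n hn (by omega) (fun _ => False)
      (fun h => by simp only [List.mem_cons, List.not_mem_nil, or_false] at h; omega)
      (fun h => by simp only [List.mem_cons, List.not_mem_nil, or_false] at h; omega)
      (fun h => by simp only [List.mem_cons, List.not_mem_nil, or_false] at h; omega)
      (fun h => by simp only [List.mem_cons, List.not_mem_nil, or_false] at h; omega)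
      (fun h => by simp only [List.mem_cons, List.not_mem_nil, or_false] at h; omega)
      (fun h => by simp only [List.mem_cons, List.not_mem_nil, or_false] at h; omega)
      (fun h => by simp only [List.mem_cons, List.not_mem_nil, or_false] at h; omega)
      (fun h => by simp only [List.mem_cons, List.not_mem_nil, or_false] at h; omega)
      (fun h => by
        simp only [List.mem_cons, List.not_mem_nil, or_false] at h
        rcases h with rfl
        all_goals first | omega | exact hLR (by decide +kernel))
      (fun h => by simp only [List.mem_cons, List.not_mem_nil, or_false] at h; omega)
      (fun h => by simp only [List.mem_cons, List.not_mem_nil, or_false] at h; omega) o ho).2).elim id False.elim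

/-- **`CONJ_LR32_L2` at `ℓ = 311` (level `9952 = 2⁵·311`) holds in every model whose level-9952 newforms are the listed certified orbits of
`Levels/N9952.lean`** (computed hypothesis `DataComplete`; vacuous: the coarse residual exponents are all `< 17`). -/
theorem CONJ_LR32_L2At_311 (M : NewformModel) (hD : M.DataComplete 9952 level9952Orbits) : CONJ_LR32_L2At M 311 :=
  CONJ_LR32_L2At_of_eliminated_lr M (by norm_num) hD level9952_wellformed fun n hn h17 _ _ o ho =>
    ((level9952_sieve n hn (by omega) (fun _ => False)
      (fun h => by simp only [List.mem_cons, List.not_mem_nil, or_false] at h; omega)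
      (fun h => by simp only [List.mem_cons, List.not_mem_nil, or_false] at h; omega)
      (fun h => by simp only [List.mem_cons, List.not_mem_nil, or_false] at h; omega)
      (fun h => by simp only [List.mem_cons, List.not_mem_nil, or_false] at h; omega)
      (fun h => by simp only [List.mem_cons, List.not_mem_nil, or_false] at h; omega)
      (fun h => by simp only [List.mem_cons, List.not_mem_nil, or_false] at h; omega)
      (fun h => by simp only [List.mem_cons, List.not_mem_nil, or_false] at h; omega)
      (fun h => by simp only [List.mem_cons, List.not_mem_nil, or_false] at h; omega) o ho).2).elim id False.elim

/-- **`CONJ_LR32_L2` at `ℓ = 317` (level `10144 = 2⁵·317`) holds in every model whose level-10144 newforms are the listed certified orbits of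
`Levels/N10144.lean`** (computed hypothesis `DataComplete`; the coarse residual primes `≥ 17` are [17, 37] ⊆ `R₃₂(317)` = [2, 5, 17, 37] (level raising, excluded by the slice hypothesis; `decide`)). -/
theorem CONJ_LR32_L2At_317 (M : NewformModel) (hD : M.DataComplete 10144 level10144Orbits) : CONJ_LR32_L2At M 317 :=
  CONJ_LR32_L2At_of_eliminated_lr M (by norm_num) hD level10144_wellformed fun n hn h17 _ hLR o ho =>
    ((level10144_sieve n hn (by omega) (fun _ => False)
      (fun h => by simp only [List.mem_cons, List.not_mem_nil, or_false] at h; omega)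
      (fun h => by simp only [List.mem_cons, List.not_mem_nil, or_false] at h; omega)
      (fun h => by simp only [List.mem_cons, List.not_mem_nil, or_false] at h; omega)
      (fun h => by
        simp only [List.mem_cons, List.not_mem_nil, or_false] at h
        rcases h with rfl | rfl
        all_goals first | omega | exact hLR (by decide +kernel))
      (fun h => by
        simp only [List.mem_cons, List.not_mem_nil, or_false] at h
        rcases h with rfl
        all_goals first | omega | exact hLR (by decide +kernel))
      (fun h => by simp only [List.mem_cons, List.not_mem_nil, or_false] at h; omega)
      (fun h => by simp only [List.mem_cons, List.not_mem_nil, or_false] at h; omega)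
      (fun h => by simp only [List.mem_cons, List.not_mem_nil, or_false] at h; omega) o ho).2).elim id False.elim

end Summit.Ventures.AbcSig.Conjectures
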